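import Summits.BirchSwinnertonDyer.Rank1Residual.X11b.Three.HsiehDescentTwist
import Summits.BirchSwinnertonDyer.Rank1Residual.X11b.Three.HsiehDescentPeriod
import Summits.BirchSwinnertonDyer.Rank1Residual.X11b.Three.HsiehDescent
import Summits.BirchSwinnertonDyer.Rank1Residual.X11b.UnrIntegersUnitPowers
import Summits.BirchSwinnertonDyer.Rank1Residual.X11b.AnticyclotomicEmbedding
import Summits.BirchSwinnertonDyer.Rank1Residual.X11b.CharacterSupply
import HarnessLib

/-!
# X11b @ `p = 3`, S29 K4: the descent node `Three.HsiehDescentAt₃ W` from VALUE RECIPROCITY (VR),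
# modulo the two labelled `p`-adic inputs of package K3 — the ASSEMBLY

HONEST FRAMING (cell `b2b-bsdres`, run/shared/lean/b2b/bsd-rank1-residual/, verbatim in every
file): the goal of the cell is to DELETE the COMBINATION-SHAPED residual classes of the
Birch–Swinnerton-Dyer formula for ALL analytic-rank `≤ 1` elliptic curves over `ℚ` — assembled
STRICTLY from published theorems — so that the rank-`≤ 1` remainder becomes exactly the
CONSTRUCTION-SHAPED classes, which are TYPED, NOT attempted. This is not "finishing BSD". Team N8/O2
(X11b at `3`); deal S29 (x11b3-lead GEN 8, OWNERS R9-8/R9-14/R9-21/R9-29/R9-30/R9-41), package K4,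
seat `b2b-bsdres-x11b3-p7` (gen. 5). **WORDING OF RECORD (H45, R9-8): S29 RE-EXPRESSES (t) ⟸ (VR).**
This file proves a CONDITIONAL theorem: its three hypotheses `hVR` (value reciprocity, the planner's
`K4InlineShape` text of x11b3-r1 v3 VERBATIM — NOT a published numbered theorem but an assembled
consequence, kept as a LABELLED HYPOTHESIS), `hSen` (package K3: local Kronecker–Weber + Lang + Tate's
`H⁰(ℂ₃(χ^j)) = 0`; NO Sen theory — the name is a label) and `hUnr` (package K3/T6: a number field
unramified above `3` embeds into `ℚ₃^{ur}`) are EXPLICIT; the file discharges none of them. The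
node `Three.HsiehDescentAt₃` is UNCHANGED — nothing is appended to it, no `_holds` is claimed; O2
OPEN / N8 CONSTRUCTION; nothing booked; no mark / label / count / tier moved. THEOREMS ONLY (no
definition, no named fact, no `sorry`).

## What this file proves

**`Three.hsiehDescentAt₃_of_valueReciprocity : hVR → hSen → hUnr → HsiehDescentAt₃ W`.**
Road (r2's (T′), plan `s25/K4-PLAN.md`, interfaces `s25/K4-INTERFACES.md` v4): for a Hsieh witness
`(A, Ω_K, C, Ω_p, Q)` put `E = ι′⁻¹(C)⁻¹Q`, `θ = ι′⁻¹((3/16A²)(Ω/Ω_K)⁴)Ω_p⁴`. For every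
`τ ∈ Gal(ℚ̄₃/ℚ₃)` (continuous extension `T_τ` to `ℂ₃`, K4 file 0) and `σ_τ = ι′τι′⁻¹ ∈ Aut(ℂ/K)`
(K1 prelude), (VR-A) and K4-C2a `exists_twist` (K4-A + multr1-p1's binomial rigidity) give
`T_τĒ = ι′⁻¹(d_σ)·(1+T)^{a_τ}·Ē`; K4-B `twistExponent_eq_zero_of_inertia` (GIVEN `hSen`) gives
`a_τ = 0` on inertia; `hUnr` + (VR-B) give exactness there, so `T_τĒ = Ē` on inertia
(`twist_unique`); x11b3-p1's Ax–Sen–Tate transport `mem_unrIntegers_of_forall_inertia_fixed_family`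
puts the coefficients of `E` in `R₀` (the series `L`); comparing `T_τ(E(y))` with `E(T_τ y)` at
range points gives `(T_τθ)^n = θ^n` whenever the value is non-zero, so `θ^g ∈ Frac R₀` for the
generator `g` of those `n` (K4-C1), and x11b3-p2's `UnrUnits.forall_exists_padicAlgCl_mul_pow_of_norm_eq_one`
(K4-C1 `exists_period_root`) yields `θ'' = β·r⁴`, `r ∈ R₀ˣ =: Ω_p′`, `β ∈ ℚ̄₃` absorbed into
`Ω_K′`; then `L`, `Ω_K′`, `Ω_p′` satisfy the node's display (prelude normal form with `C = 1`).

References: [Hsieh2014] Thm. 1; [Castella2018] Thm. 3.1; [CastellaHsieh2018] Def. 3.5; [Weil1956] §1;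
[Tate1967] §3.3; cell files OWNERS R9-8 … R9-41, r2 `gen12/S29-0c-QK2b-r2.md` §5.
-/

noncomputable section

open scoped NumberField Topology
open Filter NumberField IsDedekindDomain Field PowerSeries WeierstrassCurve
open Literature.NumberTheory.GaloisRepresentations Literature.NumberTheory.EllipticCurves
open Literature.NumberTheory.EllipticCurves.ModularForms
open Summit.BirchSwinnertonDyer.Rank1Residual.X11b.LambdaSupply
open Summit.BirchSwinnertonDyer.Rank1Residual.X11b.Three.LambdaSupply
open Summit.BirchSwinnertonDyer.Rank1Residual.X11b.PadicComplexTransport (continuous_algEquiv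
  mem_unrIntegers_of_forall_inertia_fixed_family mem_fracUnr_of_forall_inertia_fixed_family)
open Summit.BirchSwinnertonDyer.Rank1Residual.X11b.Three.RangeTransport

namespace Summit.BirchSwinnertonDyer.Rank1Residual.X11b.Three

variable (W : WeierstrassCurve ℚ) [W.IsElliptic]

/-- **S29 K4: `HsiehDescentAt₃ W` from value reciprocity, modulo the labelled K3 inputs.**
Hypotheses (all EXPLICIT, none discharged here): `hVR` = x11b3-r1's `K4InlineShape` antecedent
VERBATIM ((VR-A) cocycle clause on `Aut(ℂ/K)` with constants `c_σ, d_σ` and an ideal monomial;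
(VR-B) exactness on `Aut(ℂ/F)` for a number field `F ⊇ K` unramified above `3`); `hSen` (for any
family of continuous extensions `T_τ` of the `τ ∈ Gal(ℚ̄₃/ℚ₃)`: a continuous homomorphism
`a : Gal(ℚ̄₃/ℚ₃) → ℤ₃` admitting non-zero periods `T_τ q = ψ(a τ)·q` for all `ℤ₃`-power characters
`ψ` of rational base point near `1` vanishes on inertia — content: local Kronecker–Weber, Lang,
Tate; no Sen theory); `hUnr` (elements of a number field unramified above `3` are fixed, through
`ι⁻¹`, by every `τ` fixing the prime-to-`3` roots of unity). Conclusion: the node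
`HsiehDescentAt₃ W` (every Hsieh witness admits an `R₀`-rational re-normalisation). WORDING OF
RECORD: S29 RE-EXPRESSES (t) ⟸ (VR); nothing of the class record is supplied.
[cite: Hsieh2014, Thm. 1 (arXiv:1112.1580 pp. 3–4)] [cite: CastellaHsieh2018, Def. 3.5 and Prop. 3.6]
[cite: Tate1967, §3.3 Theorem 2] -/
theorem hsiehDescentAt₃_of_valueReciprocity
    (hVR :
  (∀ (K : Type) [Field K] [NumberField K] (𝔭 : HeightOneSpectrum (𝓞 K)) {N : ℕ} [NeZero N]
      (f : CuspForm (CongruenceSubgroup.Gamma0 N) 2),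
      IsNewformOf W f → W.conductorNorm ℤ = N → IsImaginaryQuadratic K → SatisfiesHeegnerHypothesis N K →
      ((Ideal.span {(3 : ℤ)}).primesOver (𝓞 K)).ncard = 2 → ((3 : ℕ) : 𝓞 K) ∈ 𝔭.asIdeal →
      ∃ Ω : ℂ, Ω ≠ 0 ∧
        -- (VR-A) cocycle clause on Aut(ℂ/K); ideal slot = integer-exponent monomial at primes v ∤ 3 (F-i)
        (∀ σ : ℂ ≃ₐ[ℚ] ℂ, (∀ (φ : K →+* ℂ) (k : K), σ (φ k) = φ k) →
          ∃ (c d : ℂ) (e : HeightOneSpectrum (𝓞 K) →₀ ℤ), c ≠ 0 ∧ d ≠ 0 ∧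
            (∀ v ∈ e.support, ((3 : ℕ) : 𝓞 K) ∉ v.asIdeal) ∧
            ∀ (χ : HeckeCharacter K) (n : ℕ), 0 < n →
              (∀ v : HeightOneSpectrum (𝓞 K), χ.IsUnramifiedAt v) →
              ∀ hχ : χ.HasInfinityType (fun _ ↦ (n : ℤ)) (fun _ ↦ -(n : ℤ)),
                σ (bdpInterpolationValue 3 f 𝔭 χ n Ω) =
                  d * c ^ n * (e.prod fun v k ↦ (hχ.autConj σ).valueAtUniformizer v ^ k) *
                    bdpInterpolationValue 3 f 𝔭 (hχ.autConj σ) n Ω) ∧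
        -- (VR-B) exactness clause on Aut(ℂ/F), F ⊇ K a number field unramified above 3
        (∃ F : IntermediateField ℚ ℂ, FiniteDimensional ℚ F ∧
          (∀ (φ : K →+* ℂ) (k : K), φ k ∈ F) ∧
          (∀ P : Ideal (𝓞 F), P.IsPrime → ((3 : ℕ) : 𝓞 F) ∈ P → P.ramificationIdx (𝓞 ℚ) = 1) ∧
          ∀ σ : ℂ ≃ₐ[ℚ] ℂ, (∀ x : ℂ, x ∈ F → σ x = x) →
            ∀ (χ : HeckeCharacter K) (n : ℕ), 0 < n →
              (∀ v : HeightOneSpectrum (𝓞 K), χ.IsUnramifiedAt v) →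
              ∀ hχ : χ.HasInfinityType (fun _ ↦ (n : ℤ)) (fun _ ↦ -(n : ℤ)),
                σ (bdpInterpolationValue 3 f 𝔭 χ n Ω) =
                  bdpInterpolationValue 3 f 𝔭 (hχ.autConj σ) n Ω)))
    (hSen : ∀ (T : (PadicAlgCl 3 ≃ₐ[ℚ_[3]] PadicAlgCl 3) → ℂ_[3] →+* ℂ_[3]),
      (∀ τ, Continuous (T τ)) → (∀ τ (x : PadicAlgCl 3), T τ x = τ x) →
      ∀ a : (PadicAlgCl 3 ≃ₐ[ℚ_[3]] PadicAlgCl 3) → ℤ_[3],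
        (∀ τ₁ τ₂, a (τ₁ * τ₂) = a τ₁ + a τ₂) → Continuous a →
        (∃ δ : ℝ, 0 < δ ∧ ∀ (w : ℚ_[3]) (ψ : Multiplicative ℤ_[3] →* ℂ_[3]ˣ), Continuous ψ →
          ((ψ (Multiplicative.ofAdd 1) : ℂ_[3]ˣ) : ℂ_[3]) = algebraMap ℚ_[3] ℂ_[3] w →
          ‖algebraMap ℚ_[3] ℂ_[3] w - 1‖ < δ →
          ∃ q : ℂ_[3], q ≠ 0 ∧
            ∀ τ, T τ q = ((ψ (Multiplicative.ofAdd (a τ)) : ℂ_[3]ˣ) : ℂ_[3]) * q) →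
        ∀ τ, (∀ ζ : PadicAlgCl 3, (∃ m : ℕ, 0 < m ∧ ¬ 3 ∣ m ∧ ζ ^ m = 1) → τ ζ = ζ) → a τ = 0)
    (hUnr : ∀ (ι : PadicAlgCl 3 ≃+* ℂ) (F : IntermediateField ℚ ℂ), FiniteDimensional ℚ F →
      (∀ P : Ideal (𝓞 F), P.IsPrime → ((3 : ℕ) : 𝓞 F) ∈ P → P.ramificationIdx (𝓞 ℚ) = 1) →
      ∀ τ : PadicAlgCl 3 ≃ₐ[ℚ_[3]] PadicAlgCl 3,
        (∀ ζ : PadicAlgCl 3, (∃ m : ℕ, 0 < m ∧ ¬ 3 ∣ m ∧ ζ ^ m = 1) → τ ζ = ζ) →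
        ∀ x : ℂ, x ∈ F → τ (ι.symm x) = ι.symm x) :
    HsiehDescentAt₃ W := by
  intro ι' K _ _ 𝔭 κ γ N _ f hf hX hSurj hN hKiq hodd hHeeg hsplit h3𝔭 hram hdeg hι𝔭 hℓ hκa hγ A ΩK C
    Ωp Q hA hΩK hC hΩp hQ
  -- ## 0. Basic data
  haveI : IsNonarchimedeanLocalField ℚ_[3] :=
    Literature.NumberTheory.GaloisRepresentations.Padic.isNonarchimedeanLocalField_holds 3
  have h3N : 3 ∣ N := hN ▸ dvd_conductorNorm_of_mult hX.2.2.1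
  obtain ⟨Ω, hΩ, hVRA, F, hFfin, hKF, hF3, hVRB⟩ := hVR K 𝔭 f hf hN hKiq hHeeg hsplit h3𝔭
  have hKreal : ∀ w : InfinitePlace K, ¬ w.IsReal := not_isReal_of_isImaginaryQuadratic hKiq
  have hK2 : Module.finrank ℚ K = 2 := hKiq.1
  set CC : ℂ_[3] := ((ι'.symm C : PadicAlgCl 3) : ℂ_[3]) with hCC
  have hCC0 : CC ≠ 0 := fun h ↦ by rw [h, norm_zero] at hC; exact zero_ne_one hC
  have hA' : (A : ℂ) ≠ 0 := by exact_mod_cast hA.ne'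
  have hΘ0 : ((((3 : ℕ) : ℂ) / (16 * (A : ℂ) ^ 2)) * (Ω / ΩK) ^ 4) ≠ 0 :=
    mul_ne_zero (div_ne_zero (by norm_num) (mul_ne_zero (by norm_num) (pow_ne_zero 2 hA')))
      (pow_ne_zero 4 (div_ne_zero hΩ hΩK))
  set θ : ℂ_[3] := ((ι'.symm ((((3 : ℕ) : ℂ) / (16 * (A : ℂ) ^ 2)) * (Ω / ΩK) ^ 4) : PadicAlgCl 3) :
    ℂ_[3]) * Ωp ^ 4 with hθ
  have hΩp0 : Ωp ≠ 0 := fun h ↦ by rw [h, norm_zero] at hΩp; exact zero_ne_one hΩp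
  have hθ0 : θ ≠ 0 := by
    refine mul_ne_zero ?_ (pow_ne_zero 4 hΩp0)
    rw [PadicComplex.coe_eq, map_ne_zero_iff _ (algebraMap (PadicAlgCl 3) ℂ_[3]).injective,
      map_ne_zero_iff _ ι'.symm.injective]
    exact hΘ0
  -- ## 1. The extensions `T_τ`, their coefficient maps, and `σ_τ = ι′ τ ι′⁻¹`
  choose T hT hTτ using fun τ : PadicAlgCl 3 ≃ₐ[ℚ_[3]] PadicAlgCl 3 ↦ exists_continuous_extension τ
  choose φ hφ using fun τ : PadicAlgCl 3 ≃ₐ[ℚ_[3]] PadicAlgCl 3 ↦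
    exists_restrict_padicComplexInt (hT τ) (hTτ τ)
  have hσex : ∀ τ : PadicAlgCl 3 ≃ₐ[ℚ_[3]] PadicAlgCl 3, ∃ σ : ℂ ≃ₐ[ℚ] ℂ,
      ∀ z, σ (ι' z) = ι' (τ z) := fun τ ↦ by
    obtain ⟨σ, hσ⟩ := exists_algEquiv_eq_ringEquiv
      (ι'.symm.trans ((τ : PadicAlgCl 3 ≃+* PadicAlgCl 3).trans ι'))
    exact ⟨σ, fun z ↦ by rw [hσ]; simp⟩
  choose σ hστ using hσex
  have hσK : ∀ τ (φ' : K →+* ℂ) (k : K), σ τ (φ' k) = φ' k := by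
    intro τ φ' k
    have h1 := algEquiv_apply_embedding_eq hK2 (embAt K 3 𝔭 h3𝔭 hram hdeg) τ
      (ι'.symm.toRingHom.comp φ') k
    have h2 := hστ τ (ι'.symm (φ' k))
    rw [ι'.apply_symm_apply] at h2
    rw [h2]
    change ι' (τ (ι'.symm (φ' k))) = φ' k
    rw [show τ (ι'.symm (φ' k)) = ι'.symm (φ' k) from h1, ι'.apply_symm_apply]
  -- ## 2. A base range point with `‖u − 1‖ < 1/3`, `u ≠ 1`
  obtain ⟨χ₀, m₀, ψ₀, hm₀, hunr₀, hχ₀, hav₀, hfac₀, hlt₀, hne₀⟩ :=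
    exists_interpolationCharacter (p := 3) (by norm_num) ι' K κ hKiq hκa γ hγ
  rw [avatarValueAt_unitsChar] at hlt₀
  simp_rw [avatarValueAt_unitsChar] at hne₀
  obtain ⟨k, hk⟩ : ∃ k : ℕ,
      ‖(((ψ₀ γ : (PadicAlgCl 3)ˣ) : PadicAlgCl 3) : ℂ_[3]) ^ 3 ^ k - 1‖ < ((3 : ℕ) : ℝ)⁻¹ := by
    have ht := (tendsto_pow_prime_pow_padicComplex (p := 3) hlt₀).sub_const 1
    rw [sub_self] at ht
    have hev := (Metric.tendsto_nhds.1 ht) _ (by positivity : (0 : ℝ) < ((3 : ℕ) : ℝ)⁻¹)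
    obtain ⟨k, hk⟩ := hev.exists
    exact ⟨k, by simpa only [dist_zero_right] using hk⟩
  have hn₁ : 0 < 3 ^ k * m₀ := Nat.mul_pos (pow_pos (by norm_num) k) hm₀
  have hunr₁ : ∀ v : HeightOneSpectrum (𝓞 K), (χ₀ ^ 3 ^ k).IsUnramifiedAt v :=
    fun v ↦ isUnramifiedAt_pow' (hunr₀ v) _
  have hχ₁ := hasInfinityType_pow_range hχ₀ (3 ^ k)
  have hav₁ := isPAdicAvatarOf_pow ι' hav₀ (fun v _ ↦ hunr₀ v) (3 ^ k)
  have hfac₁ := factorsThroughZp_unitsChar_pow κ hfac₀ (3 ^ k)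
  have hψ₁γ : (((ψ₀ ^ 3 ^ k) γ : (PadicAlgCl 3)ˣ) : PadicAlgCl 3) =
      ((ψ₀ γ : (PadicAlgCl 3)ˣ) : PadicAlgCl 3) ^ 3 ^ k := by
    rw [ContinuousMonoidHom.pow_apply, Units.val_pow_eq_pow_val]
  have hu : ‖((((ψ₀ ^ 3 ^ k) γ : (PadicAlgCl 3)ˣ) : PadicAlgCl 3) : ℂ_[3]) - 1‖ < ((3 : ℕ) : ℝ)⁻¹ := by
    rw [hψ₁γ, PadicComplex.coe_eq, map_pow, ← PadicComplex.coe_eq]; exact hk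
  have hu1 : (((ψ₀ ^ 3 ^ k) γ : (PadicAlgCl 3)ˣ) : PadicAlgCl 3) ≠ 1 := by
    rw [hψ₁γ]
    intro h
    apply hne₀ k
    rw [PadicComplex.coe_eq, ← map_pow, h, map_one]
  -- ## 3. The degenerate witness `Q = 0`
  by_cases hQ0 : Q = 0
  · refine ⟨ΩK, 1, 0, hΩK, fun χ n hn hunr hχ r hr hκr ↦ ?_⟩
    have hv := hQ χ n hn hunr hχ r hr hκr
    rw [hQ0] at hv
    have hval := (intSeries_hasValueAt_zero_series (p := 3) (avatarValueAt r γ - 1)).unique hv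
    rw [hsiehInterpolationValue_eq_mul_pow_mul h3N f 𝔭 χ n A ΩK C hΩ] at hval
    have hB0 : bdpInterpolationValue 3 f 𝔭 χ n Ω = 0 := by
      have h4n : 4 * n ≠ 0 := by omega
      rcases mul_eq_zero.1 hval.symm with h | h
      · rw [PadicComplex.coe_eq, map_eq_zero_iff _ (algebraMap (PadicAlgCl 3) ℂ_[3]).injective,
          map_eq_zero_iff _ ι'.symm.injective] at h
        rcases mul_eq_zero.1 h with h' | h'
        · rcases mul_eq_zero.1 h' with h'' | h''
          · exact absurd h'' fun hC0 ↦ hCC0 (by rw [hCC, hC0, map_zero]; rfl)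
          · exact absurd h'' (pow_ne_zero n hΘ0)
        · exact h'
      · exact absurd ((pow_eq_zero_iff h4n).1 h) hΩp0
    rw [hsiehInterpolationValue_eq_mul_pow_mul h3N f 𝔭 χ n A ΩK 1 hΩ, hB0, mul_zero, map_zero]
    unfold UnrSeries.HasValueAt
    simp
  -- ## 4. The normalised series `E = ι′⁻¹(C)⁻¹ · Q`
  have hCinv : ‖CC⁻¹‖ ≤ 1 := by rw [norm_inv, hC, inv_one]
  set c₀ : 𝓞_ℂ_[3] := ⟨CC⁻¹, Literature.NumberTheory.LFunctions.Dwork.mem_unitBall.2 hCinv⟩ with hc₀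
  have hc₀c : ((c₀ : 𝓞_ℂ_[3]) : ℂ_[3]) = CC⁻¹ := rfl
  set E : PowerSeries 𝓞_ℂ_[3] := PowerSeries.C c₀ * Q with hEdef
  have hE : ∀ k', ((coeff k' E : 𝓞_ℂ_[3]) : ℂ_[3]) = CC⁻¹ * ((coeff k' Q : 𝓞_ℂ_[3]) : ℂ_[3]) :=
    fun k' ↦ by rw [hEdef, coeff_C_mul, MulMemClass.coe_mul, hc₀c]
  have hE0 : E ≠ 0 := by
    intro h0
    apply hQ0
    have hc : PowerSeries.C c₀ ≠ 0 := by
      intro h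
      have : ((c₀ : 𝓞_ℂ_[3]) : ℂ_[3]) = 0 := by
        have := congrArg constantCoeff h
        rw [constantCoeff_C, map_zero] at this
        rw [this]; rfl
      exact inv_ne_zero hCC0 (hc₀c ▸ this)
    exact (mul_eq_zero.1 h0).resolve_left hc
  -- `E`'s values at range points
  have hEval : ∀ (χ : HeckeCharacter K) (n : ℕ), 0 < n →
      (∀ v : HeightOneSpectrum (𝓞 K), χ.IsUnramifiedAt v) →
      χ.HasInfinityType (fun _ ↦ (n : ℤ)) (fun _ ↦ -(n : ℤ)) →
      ∀ r : FramedGaloisRep K (PadicAlgCl 3) 1, IsPAdicAvatarOf ι' χ r → FactorsThroughZp κ r →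
        IntSeries.HasValueAt E (avatarValueAt r γ - 1)
          (θ ^ n * ((ι'.symm (bdpInterpolationValue 3 f 𝔭 χ n Ω) : PadicAlgCl 3) : ℂ_[3])) := by
    intro χ n hn hunr hχ r hr hκr
    have h := hasValueAt_of_coeff_eq_mul hE (hasValueAt_normalForm ι' hQ h3N hΩ hn hunr hχ hr hκr)
    rw [← hθ, ← hCC, ← mul_assoc, ← mul_assoc, inv_mul_cancel₀ hCC0, one_mul] at h
    exact h
  -- ## 5. The twist relations `T_τ Ē = ι′⁻¹(d_σ) (1+T)^{a_τ} Ē` and the exponent on inertia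
  choose c d e hc hd he3 hVRAτ using fun τ ↦ hVRA (σ τ) (hσK τ)
  have key := fun τ ↦ exists_twist ι' hQ h3N hΩ hθ0 hCC0 hKreal (hT τ) (hTτ τ) (hφ τ) (hστ τ)
    (hσK τ) (hc τ) (hd τ) (hVRAτ τ) hn₁ hunr₁ hχ₁ hav₁ hfac₁ hu hu1 hE0 hE
  choose a ha using key
  have hdd0 : ∀ τ, ((ι'.symm (d τ) : PadicAlgCl 3) : ℂ_[3]) ≠ 0 := fun τ ↦ by
    rw [PadicComplex.coe_eq, map_ne_zero_iff _ (algebraMap (PadicAlgCl 3) ℂ_[3]).injective,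
      map_ne_zero_iff _ ι'.symm.injective]
    exact hd τ
  have hI := twistExponent_eq_zero_of_inertia T hT hTτ hE0 hdd0 ha (hSen T hT hTτ)
  -- ## 6. Exactness on inertia: `T_τ Ē = Ē`
  have hσF : ∀ τ, (∀ ζ : PadicAlgCl 3, (∃ m : ℕ, 0 < m ∧ ¬ 3 ∣ m ∧ ζ ^ m = 1) → τ ζ = ζ) →
      ∀ x : ℂ, x ∈ F → σ τ x = x := fun τ hτ x hx ↦ by
    have h := hUnr ι' F hFfin hF3 τ hτ x hx
    calc σ τ x = σ τ (ι' (ι'.symm x)) := by rw [ι'.apply_symm_apply]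
      _ = ι' (τ (ι'.symm x)) := hστ τ _
      _ = x := by rw [h, ι'.apply_symm_apply]
  have hfix : ∀ τ, (∀ ζ : PadicAlgCl 3, (∃ m : ℕ, 0 < m ∧ ¬ 3 ∣ m ∧ ζ ^ m = 1) → τ ζ = ζ) →
      (E.map (PadicComplexInt 3).subtype).map (T τ) = E.map (PadicComplexInt 3).subtype := by
    intro τ hτ
    have hV1 : ∀ (χ : HeckeCharacter K) (n : ℕ), 0 < n →
        (∀ v : HeightOneSpectrum (𝓞 K), χ.IsUnramifiedAt v) →
        ∀ hχ : χ.HasInfinityType (fun _ ↦ (n : ℤ)) (fun _ ↦ -(n : ℤ)),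
          σ τ (bdpInterpolationValue 3 f 𝔭 χ n Ω) =
            1 * 1 ^ n * ((0 : HeightOneSpectrum (𝓞 K) →₀ ℤ).prod
              fun v k ↦ (hχ.autConj (σ τ)).valueAtUniformizer v ^ k) *
              bdpInterpolationValue 3 f 𝔭 (hχ.autConj (σ τ)) n Ω := by
      intro χ n hn hunr hχ
      rw [Finsupp.prod_zero_index, hVRB (σ τ) (hσF τ hτ) χ n hn hunr hχ]
      ring
    obtain ⟨a', ha'⟩ := exists_twist ι' hQ h3N hΩ hθ0 hCC0 hKreal (hT τ) (hTτ τ) (hφ τ) (hστ τ)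
      (hσK τ) one_ne_zero one_ne_zero hV1 hn₁ hunr₁ hχ₁ hav₁ hfac₁ hu hu1 hE0 hE
    have h1 : ((ι'.symm (1 : ℂ) : PadicAlgCl 3) : ℂ_[3]) = 1 := by rw [map_one]; rfl
    rw [h1] at ha'
    have hcmp := (ha τ).symm.trans ha'
    obtain ⟨hd1, -⟩ := twist_unique hE0 (hdd0 τ) hcmp
    rw [ha τ, hI τ hτ, hd1, binomialSeries_zero, map_one, one_mul, map_one, one_mul]
  -- ## 7. The coefficients of `E` lie in `R₀`: the series `L`
  have hcoefR : ∀ k', ((coeff k' E : 𝓞_ℂ_[3]) : ℂ_[3]) ∈ unrIntegers 3 := fun k' ↦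
    mem_unrIntegers_of_forall_inertia_fixed_family 3 T hT hTτ _
      (R1.norm_coe_padicComplexInt_le_one 3 _) fun τ hτ ↦ by
        have h := congrArg (coeff k') (hfix τ hτ)
        simpa only [coeff_map, ValuationSubring.subtype_apply] using h
  set L : UnrSeries 3 := PowerSeries.mk fun k' ↦ (⟨_, hcoefR k'⟩ : unrIntegers 3) with hL
  have hLE : ∀ k', ((coeff k' E : 𝓞_ℂ_[3]) : ℂ_[3]) = ((coeff k' L : unrIntegers 3) : ℂ_[3]) :=
    fun k' ↦ by rw [hL, coeff_mk]
  -- ## 8. `(T_τ θ)^n = θ^n` on inertia whenever a value of type `n` is non-zero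
  set S : Set ℕ := {n | ∃ (χ : HeckeCharacter K) (r : FramedGaloisRep K (PadicAlgCl 3) 1), 0 < n ∧
    (∀ v : HeightOneSpectrum (𝓞 K), χ.IsUnramifiedAt v) ∧
    χ.HasInfinityType (fun _ ↦ (n : ℤ)) (fun _ ↦ -(n : ℤ)) ∧ IsPAdicAvatarOf ι' χ r ∧
    FactorsThroughZp κ r ∧ bdpInterpolationValue 3 f 𝔭 χ n Ω ≠ 0} with hS
  have hθS : ∀ τ, (∀ ζ : PadicAlgCl 3, (∃ m : ℕ, 0 < m ∧ ¬ 3 ∣ m ∧ ζ ^ m = 1) → τ ζ = ζ) →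
      ∀ n ∈ S, (T τ θ) ^ n = θ ^ n := by
    rintro τ hτ n ⟨χ, r, hn, hunr, hχ, hr, hκr, hB⟩
    -- `r = e₁ ∘ ψ`
    set e₁ := (FramedRep.unitsContinuousMulEquivOfUnique (Fin 1) (PadicAlgCl 3) :
      (PadicAlgCl 3)ˣ →ₜ* GL (Fin 1) (PadicAlgCl 3)) with he₁
    set ψ : absoluteGaloisGroup K →ₜ* (PadicAlgCl 3)ˣ :=
      ((FramedRep.unitsContinuousMulEquivOfUnique (Fin 1) (PadicAlgCl 3)).symm :
        GL (Fin 1) (PadicAlgCl 3) →ₜ* (PadicAlgCl 3)ˣ).comp r with hψ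
    have hre : e₁.comp ψ = r := by rw [he₁, hψ, comp_symm_comp_eq]
    rw [← hre] at hr hκr
    have hτc : Continuous (τ : PadicAlgCl 3 ≃+* PadicAlgCl 3) := continuous_algEquiv τ
    -- the transported range point and its value
    have hunr' : ∀ v : HeightOneSpectrum (𝓞 K), (hχ.autConj (σ τ)).IsUnramifiedAt v :=
      fun v ↦ (hχ.isUnramifiedAt_autConj_iff (σ τ) v).mpr (hunr v)
    have hinf' := hasInfinityType_autConj_of_forall_apply_eq hχ (σ τ) (hσK τ) hKreal
    have hav' := isPAdicAvatarOf_autConj_unitsChar ι' _ hτc (σ τ) (hστ τ) hχ hr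
    have hfac' := factorsThroughZp_map_unitsChar _ hτc κ hκr
    have hv' := hEval _ n hn hunr' hinf' _ hav' hfac'
    rw [avatarValueAt_map_unitsChar _ hτc ψ γ] at hv'
    -- the value at the original point, moved by `T_τ`
    have hv := hEval χ n hn hunr hχ _ hr hκr
    rw [avatarValueAt_unitsChar] at hv
    have hmoved := hasValueAt_map_extension (hT τ) (hφ τ) hv
    have hEφ : E.map (φ τ) = E := by
      apply map_injective (PadicComplexInt 3).subtype Subtype.coe_injective
      rw [map_map_restrict (hφ τ), hfix τ hτ]
    rw [hEφ, map_sub, map_one, hTτ, map_mul, map_pow,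
      extension_coe_symm ι' (hTτ τ) (σ τ) (hστ τ), hVRB (σ τ) (hσF τ hτ) χ n hn hunr hχ] at hmoved
    have heq := hmoved.unique hv'
    have hB' : ((ι'.symm (bdpInterpolationValue 3 f 𝔭 (hχ.autConj (σ τ)) n Ω) : PadicAlgCl 3) :
        ℂ_[3]) ≠ 0 := by
      rw [← hVRB (σ τ) (hσF τ hτ) χ n hn hunr hχ, PadicComplex.coe_eq,
        map_ne_zero_iff _ (algebraMap (PadicAlgCl 3) ℂ_[3]).injective,
        map_ne_zero_iff _ ι'.symm.injective, map_ne_zero_iff _ (σ τ).injective]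
      exact hB
    exact mul_right_cancel₀ hB' heq
  obtain ⟨g, hgS, hgmem⟩ := exists_nat_generator S
  have hθg : ∀ τ, (∀ ζ : PadicAlgCl 3, (∃ m : ℕ, 0 < m ∧ ¬ 3 ∣ m ∧ ζ ^ m = 1) → τ ζ = ζ) →
      T τ (θ ^ g) = θ ^ g := fun τ hτ ↦ by
    rw [map_pow]; exact pow_eq_pow_of_forall hθ0 (hθS τ hτ) hgmem
  -- ## 9. The new periods
  obtain ⟨β, r, hr, hr1, hβ0, hβr⟩ : ∃ (β : PadicAlgCl 3) (r : ℂ_[3]), r ∈ unrIntegers 3 ∧ ‖r‖ = 1 ∧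
      β ≠ 0 ∧ ∀ n ∈ S, ((β : ℂ_[3]) * r ^ 4) ^ n = θ ^ n := by
    rcases Nat.eq_zero_or_pos g with hg0 | hgpos
    · refine ⟨1, 1, one_mem _, norm_one, one_ne_zero, fun n hn ↦ ?_⟩
      have := hgS n hn
      rw [hg0, zero_dvd_iff] at this
      rw [this, pow_zero, pow_zero]
    · have hmem := mem_fracUnr_of_forall_inertia_fixed_family 3 T hT hTτ (θ ^ g) (hθg)
      obtain ⟨β, r, hr, hr1, hβr⟩ := exists_period_root
        (UnrUnits.forall_exists_padicAlgCl_mul_pow_of_norm_eq_one) hθ0 hgpos hmem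
      have hβ0 : β ≠ 0 := by
        intro h0
        rw [h0, PadicComplex.coe_eq, map_zero, zero_mul, zero_pow hgpos.ne'] at hβr
        exact pow_ne_zero g hθ0 hβr.symm
      exact ⟨β, r, hr, hr1, hβ0, fun n hn ↦ pow_eq_pow_of_dvd hβr (hgS n hn)⟩
  have hιβ : ι' β ≠ 0 := (map_ne_zero_iff _ ι'.injective).2 hβ0
  obtain ⟨ρ, hρ⟩ := IsAlgClosed.exists_pow_nat_eq (ι' β * (16 * (A : ℂ) ^ 2) / ((3 : ℕ) : ℂ))
    (by norm_num : 0 < 4)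
  have hρ0 : ρ ≠ 0 := by
    intro h0
    rw [h0, zero_pow (by norm_num : (4 : ℕ) ≠ 0)] at hρ
    exact (div_ne_zero (mul_ne_zero hιβ (mul_ne_zero (by norm_num) (pow_ne_zero 2 hA')))
      (by norm_num)) hρ.symm
  have hΘ' : (((3 : ℕ) : ℂ) / (16 * (A : ℂ) ^ 2)) * (Ω / (Ω / ρ)) ^ 4 = ι' β := by
    have h1 : Ω / (Ω / ρ) = ρ := by field_simp
    have h3 : ((3 : ℕ) : ℂ) ≠ 0 := by norm_num
    have h16 : (16 * (A : ℂ) ^ 2) ≠ 0 := mul_ne_zero (by norm_num) (pow_ne_zero 2 hA')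
    rw [h1, hρ]
    field_simp
  have hru : IsUnit (⟨r, hr⟩ : unrIntegers 3) := (unrIntegers.isUnit_iff_norm_eq_one _).2 hr1
  refine ⟨Ω / ρ, hru.unit, L, div_ne_zero hΩ hρ0, fun χ n hn hunr hχ r' hr' hκr' ↦ ?_⟩
  -- ## 10. The display
  rw [← IntSeries.hasValueAt_iff_of_coeff_eq hLE]
  have hv := hEval χ n hn hunr hχ r' hr' hκr'
  have hrr : (((hru.unit : (unrIntegers 3)ˣ) : unrIntegers 3) : ℂ_[3]) = r := by
    rw [IsUnit.unit_spec]
  have htarget : ((ι'.symm (hsiehInterpolationValue 3 f 𝔭 χ n A (Ω / ρ) 1) : PadicAlgCl 3) : ℂ_[3]) *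
      (((hru.unit : (unrIntegers 3)ˣ) : unrIntegers 3) : ℂ_[3]) ^ (4 * n) =
      θ ^ n * ((ι'.symm (bdpInterpolationValue 3 f 𝔭 χ n Ω) : PadicAlgCl 3) : ℂ_[3]) := by
    rw [hsiehInterpolationValue_eq_mul_pow_mul h3N f 𝔭 χ n A (Ω / ρ) 1 hΩ, hΘ', one_mul,
      coe_symm_mul, coe_symm_pow, ι'.symm_apply_apply, hrr]
    by_cases hB : bdpInterpolationValue 3 f 𝔭 χ n Ω = 0
    · rw [hB, map_zero, PadicComplex.coe_zero, mul_zero, zero_mul, mul_zero]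
    · have hnS : n ∈ S := ⟨χ, r', hn, hunr, hχ, hr', hκr', hB⟩
      rw [← hβr n hnS, mul_pow, ← pow_mul]
      ring
  rw [htarget]
  exact hv

end Summit.BirchSwinnertonDyer.Rank1Residual.X11b.Three
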